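import Mathlib
import Literature.Analysis.FluidPDE.Tao2016AveragedNS.ShiftSetCascadeFlows
import Summits.NavierStokesRegularity.NavierStokesRegularity.Theorems.TaoLadderRungTwoFlatMirrorTableDefs
import Summits.NavierStokesRegularity.NavierStokesRegularity.Theorems.TaoLadderRungTwoFlatMirrorReversibility
import Summits.NavierStokesRegularity.NavierStokesRegularity.Theorems.TaoLadderRungTwoFlatQuadPolarOn
import HarnessLib

/-!
# The λ₀ = 1 layer of K_A♭, typed: pulses of the homogeneous mirror lattice, their variational equation,
  the two neutral directions, and the LINEARISED HOP CONTRACTION (S2)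
  (route-posited objects for item stmt-NavierStokesRegularity-22987 `FlatGapCertificatesV2`, crux K_A♭ of
  route TaoLadderRungTwoFlat; cell harvest/h2-tao-ladder, p1 g19 — companion of theory-1 g34's LADDER §46.4,
  whose (S1) `SymmetricPulse` / (S3) `DatumCaptured` live in the cell file Sketch46.lean; this file supplies
  the missing (S2) and the predicates it is built from, over tree declarations only)

All objects concern the HOMOGENEOUS (`ε₀ = 0`) two-species `S♭`-lattice of `mirrorTable ε ε`
(`Q := quadTermOn shiftSetFlat 0 (mirrorTable ε ε)`), the `ε₀ → 0` limit of the K_A♭ witness in the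
renormalised frame (`…Theorems.RenormFrame`).

* `IsGlobalSol ε Φ` — exact global solution (`HasDerivAt` at every time); `IsShiftPeriodic τ Φ` — the pulse
  advances one shell per period: `Φ_{i,n+1}(t+τ) = Φ_{i,n}(t)`; `IsBddFam`; `IsPulse ε τ Φ` (all three, `τ > 0`,
  non-trivial); `IsRSymmetricTraj` (via the tree's `MirrorReversibility.reflectFam`).
* `IsVariationalOn ε T Φ u` — `u` solves the LINEARISED equation `u̇ = Lin_Φ(u)` (`QuadPolar.linTermOn`) along
  `Φ` and is bounded on `[0, T]` (the uniqueness class).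
* `hasDerivAt_quadTermOn` — the chain rule `d/dt Q(Φ) = Lin_Φ(Φ̇)`; hence the two NEUTRAL DIRECTIONS are
  variational solutions: the phase direction `Φ̇ = Q(Φ)` (`isVariational_phase`) and the scale direction
  `Φ + t·Φ̇` (`isVariational_scale`), generators of the exact symmetries `Φ(· + s)` and `κΦ(κ·)`
  (`…Theorems.FlowSymmetry`). Under the hop (flow `Nτ`, shift `N` shells) the first is FIXED and the second is
  mapped to itself plus `Nτ` times the first (a Jordan block at eigenvalue `1`): no gauge can contract them —
  they must be quotiented, which is what (S2) does.
* `LinearisedHopContraction ε τ Φ` — (S2): for SOME gauge `ω > 0` on `Fin 2 × ℤ`, some `ρ < 1`, hop count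
  `N ≥ 1` and projection bound `C`, every bounded variational solution `u` along `Φ` with `ω·|u(0)| ≤ B`
  satisfies, after `N` hops read in the co-moving frame, `ω_k·|u_{k+N}(Nτ) − c₁ Φ̇_{k+N}(Nτ) − c₂ Φ_{k+N}(Nτ)| ≤ ρB`
  for some `|c₁|, |c₂| ≤ C·B`. Existential in the gauge (growing ahead, decaying behind is what works: the
  convective part of the linearised hop map is an exact shift on the vacuum region — cell screen
  P-p1g19-T1/T1b: internal spectrum `0.035, 9e-4, …` at `T♭(½)`), so it is a statement about the pulse, not
  about a norm; certifiable by one validated integration of the variational equation on a window.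

HONEST FRAMING: DEFINITIONS (predicates; nothing asserted about `mirrorTable ½ ½`) and elementary calculus
about a MODEL lattice; no pulse is constructed, nothing is certified, nothing here is a statement about the
Navier–Stokes equations.
-/

noncomputable section

-- the sub-problem namespace repeats the summit name by design (D-0017)
set_option linter.dupNamespace false

namespace Summit.NavierStokesRegularity.NavierStokesRegularity.Theorems

open Set Filter Literature.Analysis.FluidPDE Literature.Analysis.FluidPDE.TaoCascade
open scoped Topology

namespace MirrorPulse

/-! ### Exact global solutions, pulses, symmetry -/

/-- An EXACT GLOBAL SOLUTION of the homogeneous (`ε₀ = 0`) mirror lattice `Ẋ = Q(X)`,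
`Q = quadTermOn S♭ 0 (mirrorTable ε ε)`, differentiable at every time.
[cite: Tao2016AveragedNS, §4 (4.8); route TaoLadderRungTwoFlat, posited object] -/
def IsGlobalSol (ε : ℝ) (Φ : Fin 2 → ℤ → ℝ → ℝ) : Prop :=
  ∀ (i : Fin 2) (n : ℤ) (t : ℝ), HasDerivAt (Φ i n) (quadTermOn shiftSetFlat 0 (mirrorTable ε ε) Φ i n t) t

/-- SHIFT-PERIODICITY with period `τ`: the profile advances one shell per period, `Φ_{i,n+1}(t+τ) = Φ_{i,n}(t)`.
[cite: Tao2016AveragedNS, §5–§6 (self-similar ansatz); route TaoLadderRungTwoFlat, posited object] -/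
def IsShiftPeriodic (τ : ℝ) (Φ : Fin 2 → ℤ → ℝ → ℝ) : Prop :=
  ∀ (i : Fin 2) (n : ℤ) (t : ℝ), Φ i (n + 1) (t + τ) = Φ i n t

/-- A uniformly bounded family. [cite: Tao2016AveragedNS, §4 (4.5); route TaoLadderRungTwoFlat, posited object] -/
def IsBddFam (Φ : Fin 2 → ℤ → ℝ → ℝ) : Prop :=
  ∃ M : ℝ, ∀ (i : Fin 2) (n : ℤ) (t : ℝ), |Φ i n t| ≤ M

/-- A PULSE (travelling wave, one shell per period `τ > 0`) of the homogeneous mirror lattice `T♭(ε)`: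
a bounded exact global solution, shift-periodic, with charged carrier at the origin.
[cite: Tao2016AveragedNS, §5–§6 (self-similar blow-up ansatz); route TaoLadderRungTwoFlat, posited object] -/
def IsPulse (ε τ : ℝ) (Φ : Fin 2 → ℤ → ℝ → ℝ) : Prop :=
  0 < τ ∧ IsGlobalSol ε Φ ∧ IsShiftPeriodic τ Φ ∧ IsBddFam Φ ∧ Φ 0 0 0 ≠ 0

/-- An `R`-SYMMETRIC trajectory: invariant under lattice reflection composed with time reversal,
`Φ_{i,n}(t) = (RΦ)_{i,n}(−t)` with the tree's `MirrorReversibility.reflectFam`.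
[cite: Tao2016AveragedNS, §4 (4.1); route TaoLadderRungTwoFlat, posited object] -/
def IsRSymmetricTraj (Φ : Fin 2 → ℤ → ℝ → ℝ) : Prop :=
  ∀ (i : Fin 2) (n : ℤ) (t : ℝ), MirrorReversibility.reflectFam Φ i n (-t) = Φ i n t

/-! ### The variational (linearised) equation along a family -/

/-- A solution of the LINEARISED EQUATION `u̇ = Lin_Φ(u) = B(Φ,u) + B(u,Φ)` along the family `Φ`, bounded on
`[0, T]` (the class in which the linear lattice problem is well posed).
[cite: Tao2016AveragedNS, §4 (4.8); route TaoLadderRungTwoFlat, posited object] -/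
def IsVariationalOn (ε T : ℝ) (Φ u : Fin 2 → ℤ → ℝ → ℝ) : Prop :=
  (∀ (i : Fin 2) (n : ℤ) (t : ℝ),
      HasDerivAt (u i n) (QuadPolar.linTermOn shiftSetFlat 0 (mirrorTable ε ε) Φ u i n t) t) ∧
    ∃ M : ℝ, ∀ (i : Fin 2) (n : ℤ), ∀ t ∈ Icc 0 T, |u i n t| ≤ M

/-- **(S2) LINEARISED HOP CONTRACTION modulo the two neutral directions.** For some gauge `ω > 0`,
contraction factor `ρ < 1`, hop count `N ≥ 1` and projection bound `C`: every variational solution `u`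
along `Φ`, bounded on `[0, Nτ]`, with `ω·|u(0)| ≤ B`, is after `N` hops — read `N` shells up at time `Nτ` —
within `ρB` in the gauge of the span of the phase direction `Φ̇ = Q(Φ)` and the scale direction `Φ` there,
with coefficients `|c₁|, |c₂| ≤ C·B`. A predicate on `(ε, τ, Φ)`; nothing asserted.
[cite: Tao2016AveragedNS, §6.3–6.4 (statement shape of a contraction certificate); route TaoLadderRungTwoFlat, posited object, λ₀ = 1 layer (S2)] -/
def LinearisedHopContraction (ε τ : ℝ) (Φ : Fin 2 → ℤ → ℝ → ℝ) : Prop :=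
  ∃ (ω : Fin 2 → ℤ → ℝ) (ρ C : ℝ) (N : ℕ), (∀ i k, 0 < ω i k) ∧ 0 ≤ ρ ∧ ρ < 1 ∧ 0 ≤ C ∧ 1 ≤ N ∧
    ∀ (u : Fin 2 → ℤ → ℝ → ℝ) (B : ℝ), IsVariationalOn ε (N * τ) Φ u →
      (∀ i k, ω i k * |u i k 0| ≤ B) →
        ∃ c₁ c₂ : ℝ, |c₁| ≤ C * B ∧ |c₂| ≤ C * B ∧
          ∀ (i : Fin 2) (k : ℤ),
            ω i k * |u i (k + N) (N * τ)
              - c₁ * quadTermOn shiftSetFlat 0 (mirrorTable ε ε) Φ i (k + N) (N * τ)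
              - c₂ * Φ i (k + N) (N * τ)| ≤ ρ * B

/-! ### Calculus: the chain rule for `Q` and the two neutral directions -/

/-- The polarisation only reads its two families at the evaluation time.
[cite: Tao2016AveragedNS, §4 (4.8)] -/
theorem bilinOn_congr_time {m : ℕ} (𝕊 : Finset (ℤ × ℤ × ℤ)) (ε₀ : ℝ)
    (α : Fin m → Fin m → Fin m → ℤ × ℤ × ℤ → ℝ) {X X' Y Y' : Fin m → ℤ → ℝ → ℝ} {t : ℝ}
    (hX : ∀ j k, X j k t = X' j k t) (hY : ∀ j k, Y j k t = Y' j k t) (i : Fin m) (n : ℤ) :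
    QuadPolar.bilinOn 𝕊 ε₀ α X Y i n t = QuadPolar.bilinOn 𝕊 ε₀ α X' Y' i n t := by
  unfold QuadPolar.bilinOn
  refine Finset.sum_congr rfl fun _ _ => Finset.sum_congr rfl fun _ _ => Finset.sum_congr rfl fun _ _ => ?_
  rw [hX, hY]

/-- **Chain rule for the nonlinearity**: if every `X_{j,k}` has derivative `X'_{j,k}(t)` at `t`, then
`t ↦ Q(X)_{i,n}(t)` has derivative `Lin_X(X')_{i,n}(t) = B(X,X') + B(X',X)` at `t` (any shift set, any ratio).
[cite: Tao2016AveragedNS, §4 (4.8)] -/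
theorem hasDerivAt_quadTermOn {m : ℕ} (𝕊 : Finset (ℤ × ℤ × ℤ)) (ε₀ : ℝ)
    (α : Fin m → Fin m → Fin m → ℤ × ℤ × ℤ → ℝ) {X X' : Fin m → ℤ → ℝ → ℝ} {t : ℝ}
    (hX : ∀ j k, HasDerivAt (X j k) (X' j k t) t) (i : Fin m) (n : ℤ) :
    HasDerivAt (fun s => quadTermOn 𝕊 ε₀ α X i n s) (QuadPolar.linTermOn 𝕊 ε₀ α X X' i n t) t := by
  unfold QuadPolar.linTermOn QuadPolar.bilinOn quadTermOn
  rw [← Finset.sum_add_distrib]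
  refine HasDerivAt.fun_sum fun i₁ _ => ?_
  rw [← Finset.sum_add_distrib]
  refine HasDerivAt.fun_sum fun i₂ _ => ?_
  rw [← Finset.sum_add_distrib]
  refine HasDerivAt.fun_sum fun μ _ => ?_
  have h := ((hX i₁ (n - μ.2.2 + μ.1)).mul (hX i₂ (n - μ.2.2 + μ.2.1))).const_mul
    (α i₁ i₂ i μ * (1 + ε₀) ^ ((5 : ℝ) * (n - μ.2.2) / 2))
  exact h.congr_deriv (by ring)

/-- **The PHASE direction is a variational solution**: along an exact global solution `Φ`, the velocity
`Φ̇ = Q(Φ)` solves the linearised equation (generator of the time-translation symmetry).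
[cite: Tao2016AveragedNS, §4 (4.8)] -/
theorem hasDerivAt_phase {ε : ℝ} {Φ : Fin 2 → ℤ → ℝ → ℝ} (hΦ : IsGlobalSol ε Φ)
    (i : Fin 2) (n : ℤ) (t : ℝ) :
    HasDerivAt (fun s => quadTermOn shiftSetFlat 0 (mirrorTable ε ε) Φ i n s)
      (QuadPolar.linTermOn shiftSetFlat 0 (mirrorTable ε ε) Φ
        (fun j k s => quadTermOn shiftSetFlat 0 (mirrorTable ε ε) Φ j k s) i n t) t :=
  hasDerivAt_quadTermOn shiftSetFlat 0 (mirrorTable ε ε) (fun j k => hΦ j k t) i n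

/-- `Lin_Φ(Φ) = 2·Q(Φ)` (Euler's identity for the quadratic field). [cite: Tao2016AveragedNS, §4 (4.8)] -/
theorem linTermOn_self {m : ℕ} (𝕊 : Finset (ℤ × ℤ × ℤ)) (ε₀ : ℝ)
    (α : Fin m → Fin m → Fin m → ℤ × ℤ × ℤ → ℝ) (X : Fin m → ℤ → ℝ → ℝ) (i : Fin m) (n : ℤ) (t : ℝ) :
    QuadPolar.linTermOn 𝕊 ε₀ α X X i n t = 2 * quadTermOn 𝕊 ε₀ α X i n t := by
  rw [QuadPolar.linTermOn, QuadPolar.quadTermOn_eq_bilinOn]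
  ring

/-- **The SCALE direction is a variational solution**: along an exact global solution `Φ`, the generator
`t ↦ Φ(t) + t·Φ̇(t)` of the scaling symmetry `κ ↦ κΦ(κt)` solves the linearised equation.
[cite: Tao2016AveragedNS, §4 (4.8)] -/
theorem hasDerivAt_scale {ε : ℝ} {Φ : Fin 2 → ℤ → ℝ → ℝ} (hΦ : IsGlobalSol ε Φ)
    (i : Fin 2) (n : ℤ) (t : ℝ) :
    HasDerivAt (fun s => Φ i n s + s * quadTermOn shiftSetFlat 0 (mirrorTable ε ε) Φ i n s)
      (QuadPolar.linTermOn shiftSetFlat 0 (mirrorTable ε ε) Φ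
        (fun j k s => Φ j k s + s * quadTermOn shiftSetFlat 0 (mirrorTable ε ε) Φ j k s) i n t) t := by
  set Q : Fin 2 → ℤ → ℝ → ℝ := fun j k s => quadTermOn shiftSetFlat 0 (mirrorTable ε ε) Φ j k s with hQ
  -- derivative of the candidate: Φ̇ + (Q + t·Lin_Φ(Q))
  have h1 : HasDerivAt (fun s => Φ i n s + s * Q i n s)
      (Q i n t + (1 * Q i n t + t * QuadPolar.linTermOn shiftSetFlat 0 (mirrorTable ε ε) Φ Q i n t)) t := by
    refine (hΦ i n t).add ?_
    exact (hasDerivAt_id t).mul (hasDerivAt_phase hΦ i n t)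
  -- the linearisation of the candidate at time t: Lin_Φ(Φ) + t·Lin_Φ(Q) = 2Q + t·Lin_Φ(Q)
  have h2 : QuadPolar.linTermOn shiftSetFlat 0 (mirrorTable ε ε) Φ (fun j k s => Φ j k s + s * Q j k s) i n t =
      2 * Q i n t + t * QuadPolar.linTermOn shiftSetFlat 0 (mirrorTable ε ε) Φ Q i n t := by
    have e : QuadPolar.linTermOn shiftSetFlat 0 (mirrorTable ε ε) Φ (fun j k s => Φ j k s + s * Q j k s) i n t =
        QuadPolar.linTermOn shiftSetFlat 0 (mirrorTable ε ε) Φ (Φ + t • Q) i n t := by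
      unfold QuadPolar.linTermOn
      rw [bilinOn_congr_time shiftSetFlat 0 _ (X := Φ) (X' := Φ) (Y := fun j k s => Φ j k s + s * Q j k s)
          (Y' := Φ + t • Q) (fun _ _ => rfl) (fun _ _ => by simp) i n,
        bilinOn_congr_time shiftSetFlat 0 _ (X := fun j k s => Φ j k s + s * Q j k s) (X' := Φ + t • Q)
          (Y := Φ) (Y' := Φ) (fun _ _ => by simp) (fun _ _ => rfl) i n]
    rw [e, QuadPolar.linTermOn_add, QuadPolar.linTermOn_smul, linTermOn_self]
  rw [h2]
  convert h1 using 1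
  ring

/-- Under shift-periodicity the phase direction is FIXED by the hop: `Φ̇_{i,n+1}(t+τ) = Φ̇_{i,n}(t)`, read
through the equation. [cite: Tao2016AveragedNS, §4 (4.8)] -/
theorem quadTermOn_shiftPeriodic {ε τ : ℝ} {Φ : Fin 2 → ℤ → ℝ → ℝ} (hper : IsShiftPeriodic τ Φ)
    (i : Fin 2) (n : ℤ) (t : ℝ) :
    quadTermOn shiftSetFlat 0 (mirrorTable ε ε) Φ i (n + 1) (t + τ) =
      quadTermOn shiftSetFlat 0 (mirrorTable ε ε) Φ i n t := by
  unfold quadTermOn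
  refine Finset.sum_congr rfl fun i₁ _ => Finset.sum_congr rfl fun i₂ _ => Finset.sum_congr rfl fun μ _ => ?_
  have h1 : Φ i₁ (n + 1 - μ.2.2 + μ.1) (t + τ) = Φ i₁ (n - μ.2.2 + μ.1) t := by
    rw [show n + 1 - μ.2.2 + μ.1 = (n - μ.2.2 + μ.1) + 1 by ring]; exact hper _ _ _
  have h2 : Φ i₂ (n + 1 - μ.2.2 + μ.2.1) (t + τ) = Φ i₂ (n - μ.2.2 + μ.2.1) t := by
    rw [show n + 1 - μ.2.2 + μ.2.1 = (n - μ.2.2 + μ.2.1) + 1 by ring]; exact hper _ _ _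
  rw [h1, h2]
  norm_num

/-- The SCALE direction after one hop is itself PLUS `τ` times the phase direction (a Jordan block at `1`):
`(Φ + (t+τ)Φ̇)_{n+1}(t+τ) = (Φ + tΦ̇)_n(t) + τ·Φ̇_n(t)`. [cite: Tao2016AveragedNS, §4 (4.8)] -/
theorem scale_shiftPeriodic {ε τ : ℝ} {Φ : Fin 2 → ℤ → ℝ → ℝ} (hper : IsShiftPeriodic τ Φ)
    (i : Fin 2) (n : ℤ) (t : ℝ) :
    Φ i (n + 1) (t + τ) + (t + τ) * quadTermOn shiftSetFlat 0 (mirrorTable ε ε) Φ i (n + 1) (t + τ) =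
      (Φ i n t + t * quadTermOn shiftSetFlat 0 (mirrorTable ε ε) Φ i n t) +
        τ * quadTermOn shiftSetFlat 0 (mirrorTable ε ε) Φ i n t := by
  rw [hper, quadTermOn_shiftPeriodic hper]
  ring

/-- Packaging: (S2) asks for contraction only AFTER quotienting the span of these two directions; a pulse's
hop map can never contract them. (Trivial restatement recorded for the planner's split.)
[cite: Tao2016AveragedNS, §6.3–6.4 (statement shape); route TaoLadderRungTwoFlat, λ₀ = 1 layer] -/
theorem isShiftPeriodic_iterate {τ : ℝ} {Φ : Fin 2 → ℤ → ℝ → ℝ} (hper : IsShiftPeriodic τ Φ)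
    (N : ℕ) (i : Fin 2) (n : ℤ) (t : ℝ) : Φ i (n + N) (t + N * τ) = Φ i n t := by
  induction N with
  | zero => simp
  | succ N ih =>
    have := hper i (n + N) (t + N * τ)
    rw [show n + (N + 1 : ℕ) = n + (N : ℤ) + 1 by push_cast; ring,
      show t + ((N + 1 : ℕ) : ℝ) * τ = t + (N : ℝ) * τ + τ by push_cast; ring, this, ih]

end MirrorPulse

end Summit.NavierStokesRegularity.NavierStokesRegularity.Theorems

end
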